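import Literature.Algebra.EuclideanLattices.StatDistCompose
import Mathlib.MeasureTheory.Integral.Layercake
import Mathlib.Probability.Kernel.Basic
import HarnessLib

/-!
# Statistical distance does not increase under a Markov kernel (`Δ(μK, νK) ≤ Δ(μ, ν)`) and `|∫ f dμ - ∫ f dν| ≤ Δ` for `0 ≤ f ≤ 1`

Topic `Algebra/EuclideanLattices` (the home of `statDist`, `GaussianCosetSmoothing.lean`), sequel of
`StatDistCompose.lean` (triangle inequality, data processing under maps, products, mixtures). Proved glue
(no named fact) for the transformation reductions of BLPRS 2013 (pqc.S21, hypothesis `h₃` of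
`BLPRSReduction.lean`: a chain of Markov kernels — re-continuisation, the modulus switch of Lemma 3.5,
discretisation — applied to two input laws): **data processing for kernels**.

* `lintegral_indicatorFree_le` — for a measurable `f : α → ℝ≥0∞` with `f ≤ 1` and finite measures,
  `∫⁻ f dμ ≤ ∫⁻ f dν + Δ(μ, ν)` (layer cake: `∫⁻ f dμ = ∫₀¹ μ{f > t} dt` and
  `μ{f > t} ≤ ν{f > t} + Δ`, `StatDistCompose.measure_le_measure_add_ofReal_statDist`);
* `abs_toReal_lintegral_sub_le_statDist` — `|∫ f dμ - ∫ f dν| ≤ Δ(μ, ν)` for probability measures;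
* **`statDist_bind_le`** — for a measurable Markov kernel `K`, `Δ(μ.bind K, ν.bind K) ≤ Δ(μ, ν)`.

## References

* D. A. Levin, Y. Peres, *Markov Chains and Mixing Times*, 2nd ed., AMS 2017, Prop. 4.2 and Exercise 4.2
  (total variation is a contraction under Markov operators). [LevinPeres2017]
-/

noncomputable section

open MeasureTheory Set
open scoped ENNReal

namespace Literature.Algebra.EuclideanLattices

variable {α β : Type*} [MeasurableSpace α] [MeasurableSpace β]

/-- **Layer cake against the statistical distance**: for measurable `f ≤ 1`,
`∫⁻ f dμ ≤ ∫⁻ f dν + Δ(μ, ν)`. [cite: LevinPeres2017, Prop. 4.2 (proof)] -/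
theorem lintegral_le_lintegral_add_statDist (μ ν : Measure α) [IsFiniteMeasure μ] [IsFiniteMeasure ν]
    {f : α → ℝ≥0∞} (hf : Measurable f) (hf1 : ∀ a, f a ≤ 1) :
    ∫⁻ a, f a ∂μ ≤ ∫⁻ a, f a ∂ν + ENNReal.ofReal (statDist μ ν) := by
  -- real-valued version of `f`
  set g : α → ℝ := fun a => (f a).toReal with hg
  have hfin : ∀ a, f a ≠ ∞ := fun a => ne_top_of_le_ne_top ENNReal.one_ne_top (hf1 a)
  have hfg : ∀ a, f a = ENNReal.ofReal (g a) := fun a => (ENNReal.ofReal_toReal (hfin a)).symm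
  have hgm : Measurable g := ENNReal.measurable_toReal.comp hf
  have hg0 : ∀ a, 0 ≤ g a := fun a => ENNReal.toReal_nonneg
  have hg1 : ∀ a, g a ≤ 1 := fun a => by
    have := (ENNReal.toReal_le_toReal (hfin a) ENNReal.one_ne_top).2 (hf1 a)
    simpa using this
  have hlc : ∀ (ρ : Measure α), ∫⁻ a, f a ∂ρ = ∫⁻ t in Ioi (0 : ℝ), ρ {a | t < g a} := fun ρ => by
    simp_rw [hfg]
    exact lintegral_eq_lintegral_meas_lt ρ (Filter.Eventually.of_forall hg0) hgm.aemeasurable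
  -- the level sets are empty beyond `1`
  have hempty : ∀ t : ℝ, 1 ≤ t → ∀ ρ : Measure α, ρ {a | t < g a} = 0 := fun t ht ρ => by
    have : {a | t < g a} = ∅ := Set.eq_empty_of_forall_notMem fun a h => by
      have := hg1 a; simp only [Set.mem_setOf_eq] at h; linarith
    rw [this, measure_empty]
  have hrestr : ∀ ρ : Measure α, ∫⁻ t in Ioi (0 : ℝ), ρ {a | t < g a} = ∫⁻ t in Ioc (0 : ℝ) 1, ρ {a | t < g a} := fun ρ => by
    rw [← Ioc_union_Ioi_eq_Ioi zero_le_one, lintegral_union measurableSet_Ioi (Set.Ioc_disjoint_Ioi le_rfl)]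
    have h0 : ∫⁻ t in Ioi (1 : ℝ), ρ {a | t < g a} = 0 :=
      setLIntegral_eq_zero measurableSet_Ioi fun t ht => hempty t (le_of_lt ht) ρ
    rw [h0, add_zero]
  have hmeas : ∀ (ρ : Measure α) (t : ℝ), MeasurableSet {a | t < g a} := fun ρ t => measurableSet_lt measurable_const hgm
  rw [hlc μ, hlc ν, hrestr μ, hrestr ν]
  calc ∫⁻ t in Ioc (0 : ℝ) 1, μ {a | t < g a} ≤ ∫⁻ t in Ioc (0 : ℝ) 1, (ν {a | t < g a} + ENNReal.ofReal (statDist μ ν)) :=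
        lintegral_mono fun t => measure_le_measure_add_ofReal_statDist μ ν (hmeas μ t)
    _ = (∫⁻ t in Ioc (0 : ℝ) 1, ν {a | t < g a}) + ENNReal.ofReal (statDist μ ν) := by
        rw [lintegral_add_right _ measurable_const, lintegral_const, Measure.restrict_apply MeasurableSet.univ, Set.univ_inter,
          Real.volume_Ioc, sub_zero, ENNReal.ofReal_one, mul_one]

/-- **`|∫ f dμ - ∫ f dν| ≤ Δ(μ, ν)`** for measurable `f ≤ 1` and probability measures. [cite: LevinPeres2017, Prop. 4.2] -/
theorem abs_toReal_lintegral_sub_le_statDist (μ ν : Measure α) [IsProbabilityMeasure μ] [IsProbabilityMeasure ν]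
    {f : α → ℝ≥0∞} (hf : Measurable f) (hf1 : ∀ a, f a ≤ 1) :
    |(∫⁻ a, f a ∂μ).toReal - (∫⁻ a, f a ∂ν).toReal| ≤ statDist μ ν := by
  have hfin : ∀ (ρ : Measure α) [IsProbabilityMeasure ρ], ∫⁻ a, f a ∂ρ ≠ ∞ := fun ρ _ => by
    have h1 : ∫⁻ a, f a ∂ρ ≤ 1 := (lintegral_mono hf1).trans (by rw [lintegral_const, measure_univ, mul_one])
    exact ne_top_of_le_ne_top ENNReal.one_ne_top h1
  refine abs_toReal_sub_toReal_le (hfin μ) (hfin ν) (statDist_nonneg _ _)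
    (lintegral_le_lintegral_add_statDist μ ν hf hf1) ?_
  rw [statDist_comm]
  exact lintegral_le_lintegral_add_statDist ν μ hf hf1

/-- **Data processing for Markov kernels**: `Δ(μ.bind K, ν.bind K) ≤ Δ(μ, ν)`. [cite: LevinPeres2017, Exercise 4.2] -/
theorem statDist_bind_le {K : α → Measure β} (hK : Measurable K) [∀ a, IsProbabilityMeasure (K a)]
    (μ ν : Measure α) [IsProbabilityMeasure μ] [IsProbabilityMeasure ν] :
    statDist (μ.bind K) (ν.bind K) ≤ statDist μ ν := by
  refine statDist_le_of_forall_abs_sub_le (statDist_nonneg _ _) fun B hB => ?_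
  rw [measureReal_def, measureReal_def, Measure.bind_apply hB hK.aemeasurable, Measure.bind_apply hB hK.aemeasurable]
  exact abs_toReal_lintegral_sub_le_statDist μ ν ((Measure.measurable_coe hB).comp hK) fun a => prob_le_one


end Literature.Algebra.EuclideanLattices

end
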